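import Literature.Topology.FourManifolds.CappellShanesonNonInvertibleIdeals
import Literature.Topology.FourManifolds.CappellShanesonStandardForm
import Literature.Topology.FourManifolds.CappellShanesonDegreeOneIdeals
import HarnessLib

/-!
# The invertibility criterion for Kim–Yamada's ideals `⟨Θₙ - c, d⟩` (Iwaki Prop. 3.7 / 3.9, Remark 3.8) and the
# converse half of Iwaki's Theorem 3.11: `C(ℤ[Θₙ])` is not a group ONLY IF the two congruences have a solution

Source: K. Iwaki, *More Cappell–Shaneson spheres are standard*, Topology Appl. (2025) 109293 = arXiv:2404.05096
[Iwaki2025] (held `paper:arxiv-2404.05096`, pp. 6–7), §3.1–§3.2: Prop. 3.7, Remark 3.8, Prop. 3.9 (all three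
"[Kim–Yamada 2017-1]" = [KimYamada2023] §3) and Thm. 3.11 (= Thm. A) with its proof.  Companion of
`CappellShanesonNonInvertibleIdeals.lean` (the ⇐ half of Thm. 3.11 and the non-invertibility mechanism).

VOCABULARY as there: `ℤ[Θₙ] = AdjoinRoot (csPoly n)`, `⟨Θₙ - c, d⟩ = csIdeal c d n`, `fₙ = csPoly n`,
`f'ₙ(c) = (3c² - 1) - (2c - 1) n`, `fₙ(c) = (c³ - c - 1) - (c² - c) n` (`eval_csPoly_eq_taylor`); an ideal `I` is
INVERTIBLE in the ideal class monoid iff `[I][J] = [ℤ[Θₙ]]` for some `J`, i.e. iff some product `I · J` is a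
non-zero principal ideal `(y)` (the two phrasings are interchanged by `exists_mul_eq_span_iff`).

## What is formalised (theorems only; no definition, no named fact)

* §1 **The certificate** (mechanism of Prop. 3.7 ⇐ and Prop. 3.9): with `t = Θₙ - c`,
  `s = t² + (3c - n) t + f'ₙ(c)` one has `t s = -fₙ(c)` (`root_sub_mul_cofactor`); if `fₙ(c) = d m` and
  `u d + v m + w f'ₙ(c) = 1` then `⟨t, d⟩ · ⟨s, d⟩ = (d)` (`csIdeal_mul_span_pair_eq_span`), so `⟨Θₙ - c, d⟩` is
  invertible whenever `d` is coprime to `fₙ(c)/d` or to `f'ₙ(c)` (`exists_csIdeal_mul_eq_span_of_isCoprime`).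
* §2 **Prop. 3.7** ("Suppose `fₙ(c) ≡ 0 (mod p)`. If `p` is prime, then `⟨θₙ - c, p⟩` is a prime ideal of `ℤ[θₙ]`.
  The ideal `⟨θₙ - c, p⟩` is invertible if and only if at least one of the following conditions holds. • `c` is a
  simple root of `fₙ(x)` modulo `p`. • `p²` does not divide `fₙ(c)`"): `isPrime_csIdeal`, `iwaki2025_prop_3_7`
  ("simple root" rendered as `¬ p ∣ f'ₙ(c)`, the form used in the proof of Thm. 3.11: "`c` is a multiple root of
  `fₙ(x)` mod `p` if and only if `f'ₙ(c) ≡ 0` mod `p`").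
* §3 **Remark 3.8** ("Suppose that `p` and `q` are relatively prime integers. Then
  `⟨θₙ - c, p⟩⟨θₙ - c, q⟩ = ⟨θₙ - c, pq⟩`"): `csIdeal_mul_csIdeal_of_isCoprime`; products of invertible ideals
  are invertible (`exists_mul_eq_span_mul`).
* §4 **Prop. 3.9** ("`p` prime, `fₙ(c) ≡ 0 (mod p^k)`. • If `⟨θₙ - c, p⟩` is invertible, then `⟨θₙ - c, p^k⟩` is
  invertible. • If `fₙ(c) ≢ 0 (mod p^{k+1})`, then `⟨θₙ - c, p^k⟩` is invertible"): `iwaki2025_prop_3_9`; and the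
  contrapositive step of the proof of Thm. 3.11, `dvd_and_dvd_of_not_invertible_pow`.
* §5 **Thm. 3.11, ⇒** ("We assume `C(ℤ[θₙ])` is not a group. … We can write the element as `⟨θₙ - c, d⟩` by
  Corollary 2.19 [= the tree's `exists_csIdeal_mul_eq`, Aitchison–Rubinstein Thm. A3]. … there exist
  `⟨θₙ - c, p^k⟩` which is not invertible … there exists `⟨θₙ - c, p⟩` which is not invertible … `c` is a multiple
  root of `fₙ(x)` (mod `p`) and `p² ∣ fₙ(c)`"): `iwaki2025_thm_3_11_converse`, and the biconditional
  `iwaki2025_thm_3_11_iff` (with `iwaki2025_thm_3_11_not_group` of the companion file).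

## References
* [Iwaki2025] K. Iwaki, Topology Appl. (2025) 109293 = arXiv:2404.05096: Prop. 3.7, Rem. 3.8, Prop. 3.9, Thm. 3.11.
* [KimYamada2023] M. H. Kim, S. Yamada, Kyungpook Math. J. 63 (2023) 373–411: §3 (Dedekind–Kummer for
  `⟨Θₙ - c, p⟩`), Thm. 2.6, Prop. 2.14, Cor. 2.19.
* [AitchisonRubinstein1984] I. R. Aitchison, J. H. Rubinstein, Contemp. Math. 35 (1984), Appendix, Thm. A3.
-/

noncomputable section

open Polynomial Ideal
open scoped MatrixGroups

namespace Literature.Topology.FourManifolds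

/-! ### §0 Two phrasings of invertibility in the ideal class monoid -/

section Phrasings

variable {R : Type*} [CommRing R] [IsDomain R]

/-- `[I]` has an inverse class `[J]` (`(x)(I J) = (y) R`, `x, y ≠ 0`) iff some product `I · J'` is a non-zero
principal ideal (take `J' = x J`; conversely `x = 1`). [cite: Iwaki2025, §2.3 (ideal class monoid, invertible ideals)] -/
theorem exists_mul_eq_span_iff (I : Ideal R) :
    (∃ (J : Ideal R) (y : R), y ≠ 0 ∧ I * J = Ideal.span {y}) ↔
      ∃ (J : Ideal R) (x y : R), x ≠ 0 ∧ y ≠ 0 ∧ Ideal.span {x} * (I * J) = Ideal.span {y} * ⊤ := by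
  constructor
  · rintro ⟨J, y, hy, h⟩
    exact ⟨J, 1, y, one_ne_zero, hy, by rw [h, Ideal.span_singleton_one, Ideal.top_mul, Ideal.mul_top]⟩
  · rintro ⟨J, x, y, hx, hy, h⟩
    refine ⟨Ideal.span {x} * J, y, hy, ?_⟩
    rw [Ideal.mul_top] at h
    rw [← h, ← mul_assoc, mul_comm I, mul_assoc]

/-- **Products of invertible ideals are invertible**: `I₁ J₁ = (y₁)`, `I₂ J₂ = (y₂)` give
`(I₁ I₂)(J₁ J₂) = (y₁ y₂)`. [cite: Iwaki2025, §2.3 (the ideal class monoid is a monoid)] -/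
theorem exists_mul_eq_span_mul {I₁ I₂ : Ideal R} (h₁ : ∃ (J : Ideal R) (y : R), y ≠ 0 ∧ I₁ * J = Ideal.span {y})
    (h₂ : ∃ (J : Ideal R) (y : R), y ≠ 0 ∧ I₂ * J = Ideal.span {y}) :
    ∃ (J : Ideal R) (y : R), y ≠ 0 ∧ I₁ * I₂ * J = Ideal.span {y} := by
  obtain ⟨J₁, y₁, hy₁, e₁⟩ := h₁
  obtain ⟨J₂, y₂, hy₂, e₂⟩ := h₂
  refine ⟨J₁ * J₂, y₁ * y₂, mul_ne_zero hy₁ hy₂, ?_⟩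
  rw [mul_mul_mul_comm, e₁, e₂, Ideal.span_singleton_mul_span_singleton]

/-- **Invertibility is a class property**: if `(x) I = (y) I'` with `y ≠ 0` and `I'` is invertible, so is `I`.
[cite: Iwaki2025, §2.3 (ideal class monoid)] -/
theorem exists_mul_eq_span_of_class {I I' : Ideal R} {x y : R} (hy : y ≠ 0)
    (hxy : Ideal.span {x} * I = Ideal.span {y} * I')
    (h' : ∃ (J : Ideal R) (z : R), z ≠ 0 ∧ I' * J = Ideal.span {z}) :
    ∃ (J : Ideal R) (z : R), z ≠ 0 ∧ I * J = Ideal.span {z} := by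
  obtain ⟨J, z, hz, e⟩ := h'
  refine ⟨Ideal.span {x} * J, y * z, mul_ne_zero hy hz, ?_⟩
  rw [← mul_assoc, mul_comm I, hxy, mul_assoc, e, Ideal.span_singleton_mul_span_singleton]

end Phrasings

/-! ### §1 The certificate `⟨Θₙ - c, d⟩ · ⟨s, d⟩ = (d)` -/

section Certificate

variable {c d n : ℤ}

/-- With `t = Θₙ - c` and `s = t² + (3c - n) t + f'ₙ(c)`: `t · s = -fₙ(c)` (Taylor's formula at `c`). [cite: Iwaki2025, Thm. 3.11 (proof)] -/
theorem root_sub_mul_cofactor (c n : ℤ) :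
    (csRoot n - c) * ((csRoot n - c) ^ 2 + (3 * (c : AdjoinRoot (csPoly n)) - n) * (csRoot n - c) +
        ((3 * c ^ 2 - 1 - (2 * c - 1) * n : ℤ) : AdjoinRoot (csPoly n))) =
      -(((csPoly n).eval c : ℤ) : AdjoinRoot (csPoly n)) := by
  rw [eval_csPoly_eq_taylor]
  have h := taylor_csRoot_sub c n
  push_cast at h ⊢
  linear_combination h

/-- `⟨Θₙ - c, -d⟩ = ⟨Θₙ - c, d⟩`. [folklore] -/
private theorem csIdeal_neg (c d n : ℤ) : csIdeal c (-d) n = csIdeal c d n := by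
  apply le_antisymm <;> refine Ideal.span_le.mpr ?_ <;>
    rintro z hz <;> simp only [Set.mem_insert_iff, Set.mem_singleton_iff] at hz
  · rcases hz with rfl | rfl
    · exact root_sub_mem_csIdeal c d n
    · rw [Int.cast_neg]; exact neg_mem_iff.mpr (intCast_mem_csIdeal c d n)
  · rcases hz with rfl | rfl
    · exact root_sub_mem_csIdeal c (-d) n
    · have h := intCast_mem_csIdeal c (-d) n
      rw [Int.cast_neg, neg_mem_iff] at h
      exact h

/-- **The invertibility certificate.** If `fₙ(c) = d m` and `u d + v m + w f'ₙ(c) = 1` for some integers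
`u, v, w` (i.e. `gcd(d, fₙ(c)/d, f'ₙ(c)) = 1`), then `⟨Θₙ - c, d⟩ · ⟨s, d⟩ = (d)` for `s = t² + (3c - n) t + f'ₙ(c)`,
`t = Θₙ - c`: indeed `⟨t, d⟩⟨s, d⟩ = ⟨ts, td, sd, d²⟩ = d ⟨-m, t, s, d⟩` and `⟨m, t, s, d⟩ ∋ s - t(t + 3c - n) =
f'ₙ(c)`, hence `∋ 1`.  This is the computation behind Prop. 3.7 ⇐ and Prop. 3.9 (Kim–Yamada §3).
[cite: Iwaki2025, Prop. 3.7 and Prop. 3.9] [cite: KimYamada2023, Thm. 2.6 and Prop. 2.14 (§3, Dedekind–Kummer)] -/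
theorem csIdeal_mul_span_pair_eq_span {m u v w : ℤ} (hm : (csPoly n).eval c = d * m)
    (huvw : u * d + v * m + w * (3 * c ^ 2 - 1 - (2 * c - 1) * n) = 1) :
    csIdeal c d n * Ideal.span {(csRoot n - c) ^ 2 + (3 * (c : AdjoinRoot (csPoly n)) - n) * (csRoot n - c) +
        ((3 * c ^ 2 - 1 - (2 * c - 1) * n : ℤ) : AdjoinRoot (csPoly n)), (d : AdjoinRoot (csPoly n))} =
      Ideal.span {(d : AdjoinRoot (csPoly n))} := by
  have hts := root_sub_mul_cofactor c n
  rw [hm] at hts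
  push_cast at hts
  have h1 : ((1 : ℤ) : AdjoinRoot (csPoly n)) =
      ((u * d + v * m + w * (3 * c ^ 2 - 1 - (2 * c - 1) * n) : ℤ) : AdjoinRoot (csPoly n)) := by rw [huvw]
  push_cast at h1
  have htP : csRoot n - (c : AdjoinRoot (csPoly n)) ∈ csIdeal c d n := root_sub_mem_csIdeal c d n
  have hdP : (d : AdjoinRoot (csPoly n)) ∈ csIdeal c d n := intCast_mem_csIdeal c d n
  have hsQ : (csRoot n - c) ^ 2 + (3 * (c : AdjoinRoot (csPoly n)) - n) * (csRoot n - c) +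
      ((3 * c ^ 2 - 1 - (2 * c - 1) * n : ℤ) : AdjoinRoot (csPoly n)) ∈
      Ideal.span {(csRoot n - c) ^ 2 + (3 * (c : AdjoinRoot (csPoly n)) - n) * (csRoot n - c) +
        ((3 * c ^ 2 - 1 - (2 * c - 1) * n : ℤ) : AdjoinRoot (csPoly n)), (d : AdjoinRoot (csPoly n))} :=
    Ideal.subset_span (by simp)
  have hdQ : (d : AdjoinRoot (csPoly n)) ∈
      Ideal.span {(csRoot n - c) ^ 2 + (3 * (c : AdjoinRoot (csPoly n)) - n) * (csRoot n - c) +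
        ((3 * c ^ 2 - 1 - (2 * c - 1) * n : ℤ) : AdjoinRoot (csPoly n)), (d : AdjoinRoot (csPoly n))} :=
    Ideal.subset_span (by simp)
  apply le_antisymm
  · refine Ideal.mul_le.mpr fun a ha b hb => ?_
    obtain ⟨α, β, rfl⟩ := Ideal.mem_span_pair.mp ha
    obtain ⟨γ, δ, rfl⟩ := Ideal.mem_span_pair.mp hb
    refine Ideal.mem_span_singleton'.mpr
      ⟨-(α * γ * m) + α * δ * (csRoot n - c) + β * γ * ((csRoot n - c) ^ 2 +
        (3 * (c : AdjoinRoot (csPoly n)) - n) * (csRoot n - c) +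
        ((3 * c ^ 2 - 1 - (2 * c - 1) * n : ℤ) : AdjoinRoot (csPoly n))) + β * δ * d, ?_⟩
    push_cast
    linear_combination (-(α * γ)) * hts
  · rw [Ideal.span_singleton_le_iff_mem]
    have e : (d : AdjoinRoot (csPoly n)) =
        u * ((d : AdjoinRoot (csPoly n)) * d) -
          v * ((csRoot n - c) * ((csRoot n - c) ^ 2 + (3 * (c : AdjoinRoot (csPoly n)) - n) * (csRoot n - c) +
            ((3 * c ^ 2 - 1 - (2 * c - 1) * n : ℤ) : AdjoinRoot (csPoly n)))) +
          w * ((d : AdjoinRoot (csPoly n)) * ((csRoot n - c) ^ 2 +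
              (3 * (c : AdjoinRoot (csPoly n)) - n) * (csRoot n - c) +
              ((3 * c ^ 2 - 1 - (2 * c - 1) * n : ℤ) : AdjoinRoot (csPoly n))) -
            (csRoot n - c) * d * (csRoot n - c + (3 * (c : AdjoinRoot (csPoly n)) - n))) := by
      push_cast
      linear_combination (d : AdjoinRoot (csPoly n)) * h1 + (v : AdjoinRoot (csPoly n)) * hts
    have key := Ideal.add_mem _ (Ideal.sub_mem _ (Ideal.mul_mem_left _ (u : AdjoinRoot (csPoly n))
      (Ideal.mul_mem_mul hdP hdQ)) (Ideal.mul_mem_left _ (v : AdjoinRoot (csPoly n)) (Ideal.mul_mem_mul htP hsQ)))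
      (Ideal.mul_mem_left _ (w : AdjoinRoot (csPoly n)) (Ideal.sub_mem _ (Ideal.mul_mem_mul hdP hsQ)
        (Ideal.mul_mem_right (csRoot n - c + (3 * (c : AdjoinRoot (csPoly n)) - n)) _
          (Ideal.mul_mem_mul htP hdQ))))
    rw [← e] at key
    exact key

/-- **`⟨Θₙ - c, d⟩` is invertible when `d` is coprime to `fₙ(c)/d` or to `f'ₙ(c)`** (`fₙ(c) = d m`): some
product `⟨Θₙ - c, d⟩ · J` is the non-zero principal ideal `(d)`. [cite: Iwaki2025, Prop. 3.7 and Prop. 3.9] -/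
theorem exists_csIdeal_mul_eq_span_of_isCoprime {m : ℤ} (hm : (csPoly n).eval c = d * m)
    (hco : IsCoprime d m ∨ IsCoprime d (3 * c ^ 2 - 1 - (2 * c - 1) * n)) :
    ∃ (J : Ideal (AdjoinRoot (csPoly n))) (y : AdjoinRoot (csPoly n)), y ≠ 0 ∧ csIdeal c d n * J = Ideal.span {y} := by
  have hd0 : d ≠ 0 := by
    rintro rfl
    exact ne_zero_of_dvd_eval_csPoly (c := c) (n := n) (d := 0) ⟨m, hm⟩ rfl
  have hdR : (d : AdjoinRoot (csPoly n)) ≠ 0 := intCast_ne_zero_csRoot n hd0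
  rcases hco with ⟨u, v, huv⟩ | ⟨u, w, huw⟩
  · exact ⟨_, _, hdR, csIdeal_mul_span_pair_eq_span (u := u) (v := v) (w := 0) hm (by linear_combination huv)⟩
  · exact ⟨_, _, hdR, csIdeal_mul_span_pair_eq_span (u := u) (v := 0) (w := w) hm (by linear_combination huw)⟩

end Certificate

/-! ### §2 Proposition 3.7: `⟨Θₙ - c, p⟩` (`p` prime, `p ∣ fₙ(c)`) is prime; it is invertible iff `c` is a simple
root mod `p` or `p² ∤ fₙ(c)` -/

section Prop37

variable {c p n : ℤ}

/-- **`⟨Θₙ - c, p⟩` is a prime ideal** for `p` prime, `p ∣ fₙ(c)`: `ℤ[Θₙ]/⟨Θₙ - c, p⟩ ≅ ℤ/p`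
(`nonempty_quotient_span_ringEquiv_quotient_csIdeal`) is a domain. [cite: Iwaki2025, Prop. 3.7] -/
theorem isPrime_csIdeal (hp : Prime p) (h : p ∣ (csPoly n).eval c) : (csIdeal c p n).IsPrime := by
  obtain ⟨e⟩ := nonempty_quotient_span_ringEquiv_quotient_csIdeal h
  haveI : IsDomain (ℤ ⧸ Ideal.span {p}) :=
    (Ideal.Quotient.isDomain_iff_prime _).mpr ((Ideal.span_singleton_prime hp.ne_zero).mpr hp)
  haveI : IsDomain (AdjoinRoot (csPoly n) ⧸ csIdeal c p n) := MulEquiv.isDomain _ e.symm.toMulEquiv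
  exact (Ideal.Quotient.isDomain_iff_prime _).mp inferInstance

/-- **Iwaki 2025, Proposition 3.7 (Kim–Yamada).** "Suppose that integers `c`, `n` and `p` satisfy
`fₙ(c) ≡ 0 (mod p)`. If `p` is prime, then `⟨θₙ - c, p⟩` is a prime ideal of `ℤ[θₙ]`. The ideal `⟨θₙ - c, p⟩` is
invertible if and only if at least one of the following conditions holds. • `c` is a simple root of `fₙ(x)`
modulo `p`. • `p²` does not divide `fₙ(c)`."  Invertible = some product `⟨Θₙ - c, p⟩ · J` is a non-zero
principal ideal; "simple root mod `p`" = `p ∤ f'ₙ(c) = (3c² - 1) - (2c - 1) n` (given `p ∣ fₙ(c)`).  ⇐ by the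
certificate (`p` coprime to `f'ₙ(c)`, resp. to `fₙ(c)/p`); ⇒ is the non-invertibility of
`CappellShanesonNonInvertibleIdeals` (`csIdeal_mul_ne_span_singleton`). [cite: Iwaki2025, Prop. 3.7] [cite: KimYamada2023, §3 (Dedekind–Kummer theorem for `⟨Θₙ - c, p⟩`)] -/
theorem iwaki2025_prop_3_7 (hp : Prime p) (h : p ∣ (csPoly n).eval c) :
    (csIdeal c p n).IsPrime ∧
      ((∃ (J : Ideal (AdjoinRoot (csPoly n))) (y : AdjoinRoot (csPoly n)), y ≠ 0 ∧
          csIdeal c p n * J = Ideal.span {y}) ↔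
        ¬ p ∣ 3 * c ^ 2 - 1 - (2 * c - 1) * n ∨ ¬ p ^ 2 ∣ (csPoly n).eval c) := by
  refine ⟨isPrime_csIdeal hp h, ⟨fun hinv => ?_, fun hcases => ?_⟩⟩
  · by_contra hnot
    push Not at hnot
    obtain ⟨J, y, hy, hJ⟩ := hinv
    refine csIdeal_mul_ne_span_singleton (c := c) (p := p) (n := n)
      (fun h1 => hp.not_unit (Int.isUnit_iff_natAbs_eq.mpr h1)) hnot.1 ?_ J hy hJ
    rw [← eval_csPoly_eq_taylor]; exact hnot.2
  · obtain ⟨m, hm⟩ := h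
    rcases hcases with h₁ | h₂
    · exact exists_csIdeal_mul_eq_span_of_isCoprime hm
        (Or.inr ((Prime.coprime_iff_not_dvd hp).mpr h₁))
    · refine exists_csIdeal_mul_eq_span_of_isCoprime hm (Or.inl ((Prime.coprime_iff_not_dvd hp).mpr ?_))
      rintro ⟨k, rfl⟩
      exact h₂ ⟨k, by rw [hm]; ring⟩

end Prop37

/-! ### §3 Remark 3.8: `⟨Θₙ - c, a⟩ ⟨Θₙ - c, b⟩ = ⟨Θₙ - c, ab⟩` for coprime `a, b` -/

section Remark38

variable {c a b n : ℤ}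

/-- **Iwaki 2025, Remark 3.8 (Kim–Yamada).** "Suppose that `p` and `q` are relatively prime integers. Then
`θₙ - c` is a linear combination of `p(θₙ - c)` and `q(θₙ - c)`. It follows that
`⟨θₙ - c, p⟩⟨θₙ - c, q⟩ = ⟨(θₙ - c)², p(θₙ - c), q(θₙ - c), pq⟩ = ⟨θₙ - c, pq⟩`." [cite: Iwaki2025, Remark 3.8] -/
theorem csIdeal_mul_csIdeal_of_isCoprime (hab : IsCoprime a b) :
    csIdeal c a n * csIdeal c b n = csIdeal c (a * b) n := by
  obtain ⟨u, v, huv⟩ := hab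
  have htA : csRoot n - (c : AdjoinRoot (csPoly n)) ∈ csIdeal c a n := root_sub_mem_csIdeal c a n
  have haA : (a : AdjoinRoot (csPoly n)) ∈ csIdeal c a n := intCast_mem_csIdeal c a n
  have htB : csRoot n - (c : AdjoinRoot (csPoly n)) ∈ csIdeal c b n := root_sub_mem_csIdeal c b n
  have hbB : (b : AdjoinRoot (csPoly n)) ∈ csIdeal c b n := intCast_mem_csIdeal c b n
  apply le_antisymm
  · refine Ideal.mul_le.mpr fun x hx y hy => ?_
    obtain ⟨α, β, rfl⟩ := Ideal.mem_span_pair.mp hx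
    obtain ⟨γ, δ, rfl⟩ := Ideal.mem_span_pair.mp hy
    refine Ideal.mem_span_pair.mpr ⟨α * γ * (csRoot n - c) + α * δ * b + β * γ * a, β * δ, ?_⟩
    push_cast
    ring
  · refine Ideal.span_le.mpr ?_
    rintro z hz
    simp only [Set.mem_insert_iff, Set.mem_singleton_iff] at hz
    rcases hz with rfl | rfl
    · have e : csRoot n - (c : AdjoinRoot (csPoly n)) =
          u * ((a : AdjoinRoot (csPoly n)) * (csRoot n - c)) + v * ((csRoot n - c) * b) := by
        have h1 : ((1 : ℤ) : AdjoinRoot (csPoly n)) = ((u * a + v * b : ℤ) : AdjoinRoot (csPoly n)) := by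
          rw [huv]
        push_cast at h1
        linear_combination (csRoot n - (c : AdjoinRoot (csPoly n))) * h1
      rw [e]
      exact Ideal.add_mem _ (Ideal.mul_mem_left _ _ (Ideal.mul_mem_mul haA htB))
        (Ideal.mul_mem_left _ _ (Ideal.mul_mem_mul htA hbB))
    · rw [Int.cast_mul]
      exact Ideal.mul_mem_mul haA hbB

end Remark38

/-! ### §4 Proposition 3.9 and the prime-power step of Theorem 3.11 -/

section Prop39

variable {c p n : ℤ} {k : ℕ}

/-- **Iwaki 2025, Proposition 3.9 (Kim–Yamada).** "Suppose that `p` is a prime integer and an integer `c`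
satisfies `fₙ(c) ≡ 0 (mod p^k)` for some positive integer `k`. • If `⟨θₙ - c, p⟩` is invertible, then
`⟨θₙ - c, p^k⟩` is invertible. • If `fₙ(c) ≢ 0 (mod p^{k+1})`, then `⟨θₙ - c, p^k⟩` is invertible."  (First
bullet through Prop. 3.7: invertibility of `⟨θₙ - c, p⟩` means `p ∤ f'ₙ(c)` — then `p^k` is coprime to `f'ₙ(c)` —
or `p² ∤ fₙ(c)`, which with `p^k ∣ fₙ(c)` forces `k = 1`.) [cite: Iwaki2025, Prop. 3.9] -/
theorem iwaki2025_prop_3_9 (hp : Prime p) (hk : 0 < k) (h : p ^ k ∣ (csPoly n).eval c) :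
    ((∃ (J : Ideal (AdjoinRoot (csPoly n))) (y : AdjoinRoot (csPoly n)), y ≠ 0 ∧
        csIdeal c p n * J = Ideal.span {y}) →
      ∃ (J : Ideal (AdjoinRoot (csPoly n))) (y : AdjoinRoot (csPoly n)), y ≠ 0 ∧
        csIdeal c (p ^ k) n * J = Ideal.span {y}) ∧
    (¬ p ^ (k + 1) ∣ (csPoly n).eval c →
      ∃ (J : Ideal (AdjoinRoot (csPoly n))) (y : AdjoinRoot (csPoly n)), y ≠ 0 ∧
        csIdeal c (p ^ k) n * J = Ideal.span {y}) := by
  obtain ⟨m, hm⟩ := h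
  have hp1 : p ∣ (csPoly n).eval c := (dvd_pow_self p hk.ne').trans ⟨m, hm⟩
  constructor
  · intro hinv
    rcases ((iwaki2025_prop_3_7 hp hp1).2).mp hinv with h₁ | h₂
    · exact exists_csIdeal_mul_eq_span_of_isCoprime hm
        (Or.inr (((Prime.coprime_iff_not_dvd hp).mpr h₁).pow_left))
    · -- `p² ∤ fₙ(c)` and `p^k ∣ fₙ(c)` force `k = 1`
      obtain rfl : k = 1 := by
        by_contra hk1
        exact h₂ ((pow_dvd_pow p (show 2 ≤ k by omega)).trans ⟨m, hm⟩)
      rw [pow_one] at hm ⊢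
      exact ((iwaki2025_prop_3_7 hp hp1).2).mpr (Or.inr h₂)
  · intro hnd
    refine exists_csIdeal_mul_eq_span_of_isCoprime hm (Or.inl ?_)
    refine IsCoprime.pow_left ((Prime.coprime_iff_not_dvd hp).mpr ?_)
    rintro ⟨m', rfl⟩
    exact hnd ⟨m', by rw [hm]; ring⟩

/-- **The prime-power step in the proof of Thm. 3.11 ⇒**: if `p^k ∣ fₙ(c)` (`k ≥ 1`, `p` prime) and
`⟨Θₙ - c, p^k⟩` is NOT invertible, then `p ∣ f'ₙ(c)` and `p^{k+1} ∣ fₙ(c)` — otherwise the certificate inverts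
it ("By Proposition 3.9, there exists `⟨θₙ - c, p⟩` which is not invertible … `c` is a multiple root of `fₙ(x)`
mod `p` and `p² ∣ fₙ(c)` from Proposition 3.7"). [cite: Iwaki2025, Thm. 3.11 (proof) and Prop. 3.9] -/
theorem dvd_and_dvd_of_not_invertible_pow (hp : Prime p) (hk : 0 < k) (h : p ^ k ∣ (csPoly n).eval c)
    (hnot : ¬ ∃ (J : Ideal (AdjoinRoot (csPoly n))) (y : AdjoinRoot (csPoly n)), y ≠ 0 ∧
      csIdeal c (p ^ k) n * J = Ideal.span {y}) :
    p ∣ 3 * c ^ 2 - 1 - (2 * c - 1) * n ∧ p ^ (k + 1) ∣ (csPoly n).eval c := by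
  obtain ⟨m, hm⟩ := h
  by_contra hc
  rw [not_and_or] at hc
  rcases hc with h₁ | h₂
  · exact hnot (exists_csIdeal_mul_eq_span_of_isCoprime hm
      (Or.inr (((Prime.coprime_iff_not_dvd hp).mpr h₁).pow_left)))
  · exact hnot ((iwaki2025_prop_3_9 hp hk ⟨m, hm⟩).2 h₂)

end Prop39

/-! ### §5 Theorem 3.11, ⇒: a non-invertible class forces a solution of the congruences -/

section Converse

variable {n : ℤ}

/-- **The induction over the prime factorisation of `d`** (proof of Thm. 3.11: Remark 3.8 splits `⟨Θₙ - c, d⟩`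
into coprime prime-power factors, a non-invertible product has a non-invertible factor, and the prime-power
step yields the congruences): if `d ∣ fₙ(c)` (`d : ℕ`) and `⟨Θₙ - c, d⟩` is not invertible, then some prime `p`
satisfies `p ∣ f'ₙ(c)` and `p² ∣ fₙ(c)`. [cite: Iwaki2025, Thm. 3.11 (proof)] -/
theorem exists_prime_of_not_invertible_csIdeal (c : ℤ) (d : ℕ) (hd : (d : ℤ) ∣ (csPoly n).eval c)
    (hnot : ¬ ∃ (J : Ideal (AdjoinRoot (csPoly n))) (y : AdjoinRoot (csPoly n)), y ≠ 0 ∧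
      csIdeal c d n * J = Ideal.span {y}) :
    ∃ p : ℤ, Prime p ∧ p ∣ 3 * c ^ 2 - 1 - (2 * c - 1) * n ∧ p ^ 2 ∣ (csPoly n).eval c := by
  induction d using Nat.recOnPrimeCoprime with
  | zero =>
    exact absurd rfl (ne_zero_of_dvd_eval_csPoly (by exact_mod_cast hd))
  | prime_pow q k hq =>
    rcases Nat.eq_zero_or_pos k with rfl | hk
    · -- `d = 1`: `⟨Θₙ - c, 1⟩ = ℤ[Θₙ]` is invertible
      exfalso
      refine hnot ⟨⊤, 1, one_ne_zero, ?_⟩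
      rw [pow_zero, Nat.cast_one, show csIdeal c 1 n = ⊤ from
        (Ideal.eq_top_iff_one _).mpr (by simpa using intCast_mem_csIdeal c 1 n), Ideal.top_mul,
        Ideal.span_singleton_one]
    · have hqZ : Prime (q : ℤ) := Nat.prime_iff_prime_int.mp hq
      have hd' : (q : ℤ) ^ k ∣ (csPoly n).eval c := by exact_mod_cast hd
      have hnot' : ¬ ∃ (J : Ideal (AdjoinRoot (csPoly n))) (y : AdjoinRoot (csPoly n)), y ≠ 0 ∧
          csIdeal c ((q : ℤ) ^ k) n * J = Ideal.span {y} := by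
        simpa only [Nat.cast_pow] using hnot
      obtain ⟨h₁, h₂⟩ := dvd_and_dvd_of_not_invertible_pow hqZ hk hd' hnot'
      exact ⟨q, hqZ, h₁, (pow_dvd_pow (q : ℤ) (show 2 ≤ k + 1 by omega)).trans h₂⟩
  | coprime a b ha hb hab iha ihb =>
    have hcop : IsCoprime (a : ℤ) (b : ℤ) := Nat.isCoprime_iff_coprime.mpr hab
    have hsplit : csIdeal c ((a * b : ℕ) : ℤ) n = csIdeal c (a : ℤ) n * csIdeal c (b : ℤ) n := by
      rw [Nat.cast_mul, csIdeal_mul_csIdeal_of_isCoprime hcop]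
    have hd' : (a : ℤ) * (b : ℤ) ∣ (csPoly n).eval c := by exact_mod_cast hd
    have hda : (a : ℤ) ∣ (csPoly n).eval c := (Dvd.intro _ rfl).trans hd'
    have hdb : (b : ℤ) ∣ (csPoly n).eval c := (Dvd.intro_left _ rfl).trans hd'
    by_cases hA : ∃ (J : Ideal (AdjoinRoot (csPoly n))) (y : AdjoinRoot (csPoly n)), y ≠ 0 ∧
        csIdeal c (a : ℤ) n * J = Ideal.span {y}
    · by_cases hB : ∃ (J : Ideal (AdjoinRoot (csPoly n))) (y : AdjoinRoot (csPoly n)), y ≠ 0 ∧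
          csIdeal c (b : ℤ) n * J = Ideal.span {y}
      · exact absurd (hsplit ▸ exists_mul_eq_span_mul hA hB) hnot
      · exact ihb hdb hB
    · exact iha hda hA

/-- **Iwaki 2025, Theorem 3.11, ⇒.** "We assume `C(ℤ[θₙ])` is not a group. There exists an element in
`C(ℤ[θₙ])` which is not invertible. We can write the element as `⟨θₙ - c, d⟩` by Corollary 2.19 [the tree's
`exists_csIdeal_mul_eq`, from Aitchison–Rubinstein's Thm. A3]. … there exist `⟨θₙ - c, p^k⟩` which is not
invertible … By Proposition 3.9, there exists `⟨θₙ - c, p⟩` which is not invertible … Then, we get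
`(2c-1) n ≡ 3c² - 1 (mod p)` and `(c² - c) n ≡ c³ - c - 1 (mod p²)`."  Hypothesis: some non-zero ideal whose
class has no inverse (`(x)(I J) = (y) ℤ[Θₙ]` for no `J`, `x, y ≠ 0`). [cite: Iwaki2025, Thm. 3.11] [cite: AitchisonRubinstein1984, Appendix, Theorem A3] -/
theorem iwaki2025_thm_3_11_converse
    (h : ∃ I : Ideal (AdjoinRoot (csPoly n)), I ≠ ⊥ ∧
      ¬ ∃ (J : Ideal (AdjoinRoot (csPoly n))) (x y : AdjoinRoot (csPoly n)), x ≠ 0 ∧ y ≠ 0 ∧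
        Ideal.span {x} * (I * J) = Ideal.span {y} * ⊤) :
    ∃ c p : ℤ, Prime p ∧ (2 * c - 1) * n ≡ 3 * c ^ 2 - 1 [ZMOD p] ∧
      (c ^ 2 - c) * n ≡ c ^ 3 - c - 1 [ZMOD p ^ 2] := by
  obtain ⟨I, hI, hnot⟩ := h
  rw [← exists_mul_eq_span_iff] at hnot
  obtain ⟨c, d, hd, x, y, hx, hy, hxy⟩ := exists_csIdeal_mul_eq n hI
  -- the degree-one representative `⟨Θₙ - c, |d|⟩` of the class is not invertible either
  have hnotC : ¬ ∃ (J : Ideal (AdjoinRoot (csPoly n))) (z : AdjoinRoot (csPoly n)), z ≠ 0 ∧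
      csIdeal c (d.natAbs : ℤ) n * J = Ideal.span {z} := by
    intro hC
    have hC' : ∃ (J : Ideal (AdjoinRoot (csPoly n))) (z : AdjoinRoot (csPoly n)), z ≠ 0 ∧
        csIdeal c d n * J = Ideal.span {z} := by
      rcases Int.natAbs_eq d with hdd | hdd
      · rwa [← hdd] at hC
      · rwa [Int.natCast_natAbs, show |d| = -d by rw [abs_eq_neg_self]; omega, csIdeal_neg] at hC
    exact hnot (exists_mul_eq_span_of_class hy hxy hC')
  obtain ⟨p, hp, h₁, h₂⟩ :=
    exists_prime_of_not_invertible_csIdeal c d.natAbs (Int.natAbs_dvd.mpr hd) hnotC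
  refine ⟨c, p, hp, Int.modEq_iff_dvd.mpr h₁, Int.modEq_iff_dvd.mpr ?_⟩
  rwa [eval_csPoly_eq_taylor] at h₂

/-- **Iwaki 2025, Theorem 3.11 (= Theorem A), as a biconditional.** "`C(ℤ[θₙ])` is not a group if and only if
there exist an integer `c` and a prime number `p` which satisfy `(2c-1) n ≡ 3c² - 1 (mod p)` and
`(c² - c) n ≡ c³ - c - 1 (mod p²)`" — "not a group" = some non-zero ideal class has no inverse (Thm. 3.6:
"`C(R)` is a group ⟺ every ideal of `R` is invertible"). ⇐ is `iwaki2025_thm_3_11_not_group`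
(`CappellShanesonNonInvertibleIdeals`). [cite: Iwaki2025, Thm. 3.11 and Thm. 3.6] -/
theorem iwaki2025_thm_3_11_iff (n : ℤ) :
    (∃ I : Ideal (AdjoinRoot (csPoly n)), I ≠ ⊥ ∧
      ¬ ∃ (J : Ideal (AdjoinRoot (csPoly n))) (x y : AdjoinRoot (csPoly n)), x ≠ 0 ∧ y ≠ 0 ∧
        Ideal.span {x} * (I * J) = Ideal.span {y} * ⊤) ↔
    ∃ c p : ℤ, Prime p ∧ (2 * c - 1) * n ≡ 3 * c ^ 2 - 1 [ZMOD p] ∧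
      (c ^ 2 - c) * n ≡ c ^ 3 - c - 1 [ZMOD p ^ 2] :=
  ⟨iwaki2025_thm_3_11_converse, fun ⟨_, _, hp, h₁, h₂⟩ => iwaki2025_thm_3_11_not_group hp h₁ h₂⟩

end Converse

end Literature.Topology.FourManifolds

end
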